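import Summits.AnomalousDissipation.AnomalousDissipation.Theses.MomentParity
import Summits.AnomalousDissipation.AnomalousDissipation.Theorems.QuarticGate.Negative.EnergyRow
import Summits.AnomalousDissipation.AnomalousDissipation.Theorems.MomentParityMomentClosureCarrier
import Literature.Analysis.FluidPDE.StatisticalSolutionEnergyEq
import Literature.Analysis.FluidPDE.CylindricalGenerator
import Literature.Analysis.FunctionSpaces.TorusTrigPoly

/-!
# Stub L′ `stub_continuous_flux` for line `lions-l4-domination` of crux
# `MomentParity.ResolvedDissipation` (stmt-AnomalousDissipation-14284)

**The Galerkin energy fluxes are norm-continuous on `H`.** For every cutoff `m` the energy flux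
through the modes `|k| ≤ m`,
`Π_m(u) = ∫ (u ⊗ u) : ∇P_m u = Torus.inertialPairing u (Torus.fourierTruncate m u)`,
is a continuous function of `u ∈ H = L²_σ(T³)` (norm topology). Consequence used by the lead's
skeleton: the maximal flux `Π*(u) = sup_m |Π_m(u)|` is lower semicontinuous on `H`, so an
`N`-uniform bound on its mean passes to Galerkin limits by the lsc portmanteau.

Proof (folklore; the moving-test-field version of `Torus.continuous_inertialPairing`). Write
`B_c(a, b) = ∫ ⟪D(realTrigPoly S c)(x) a(x), b(x)⟫` for coefficients `c` on the frequency ball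
`S = freqBall m` and `a, b ∈ L²`. By `Torus.integrable_inner_fderiv_apply_coe` and the pointwise
derivative bound `‖∂ⱼ realTrigPoly S c‖ ≤ Σ_{k ∈ S} 2π|kⱼ| ‖c k‖`
(`Torus.norm_partialDeriv_realTrigPoly_le`), `|B_c(a, b)| ≤ K(c) ‖a‖ ‖b‖` with
`K(c) = Σᵢ Σ_{k ∈ S} 2π|kᵢ| ‖c k‖`; `B` is bilinear in `(a, b)` and additive in `c`
(`Torus.realTrigPoly_add`, `Torus.fderiv_add`). Hence the JOINT estimate
`|B_c(a,a) − B_{c′}(b,b)| ≤ K(c) (‖a − b‖ ‖a‖ + ‖b‖ ‖a − b‖) + K(c − c′) ‖b‖²`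
(`abs_integral_inner_fderiv_realTrigPoly_sub_le`). With `c = û|_S`, `c′ = v̂₀|_S`
(`P_m u = realTrigPoly S û`, `Torus.fourierTruncate_eq`) the right-hand side is a continuous
function of `u ∈ H` vanishing at `u = v₀`, because each Fourier coefficient `u ↦ û(k)` is
continuous on `H` (`MomentParityMomentClosure.continuous_mFourierCoeff_coe`).

## References

* C. Foias, O. Manley, R. Rosa, R. Temam, *Navier–Stokes Equations and Turbulence*, Cambridge
  Univ. Press (2001), Ch. II (A.28)–(A.31) (the trilinear form), Ch. IV §1.1 (1.7)–(1.9);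
  App. B.2 (continuity of the tested generator on `H`). [FMRTTurbulence2001]
-/

noncomputable section

set_option linter.dupNamespace false

namespace Summit.AnomalousDissipation.AnomalousDissipation.Theorems.MomentParityResolvedDissipation.ContinuousFlux

open MeasureTheory Filter Topology
open scoped ENNReal NNReal InnerProductSpace RealInnerProductSpace
open Literature.Analysis.FunctionSpaces Literature.Analysis.FluidPDE
open Summit.AnomalousDissipation.AnomalousDissipation.Theses.MomentParity
open Summit.AnomalousDissipation.AnomalousDissipation.Theorems.QuarticGate.Negative

variable {d : Type*} [Fintype d] [DecidableEq d]

/-! ### The convective bilinear form of a real trigonometric polynomial -/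

/-- **The convective form of a trigonometric polynomial is bounded on `L²`**: for coefficients
`c` on a finite frequency set `S` and `a, b ∈ L²`, the integrand `⟪D(realTrigPoly S c) a, b⟫`
is integrable and `|∫ ⟪D(realTrigPoly S c)(x) a(x), b(x)⟫| ≤ K(c) ‖a‖ ‖b‖` with
`K(c) = Σᵢ Σ_{k ∈ S} 2π |kᵢ| ‖c k‖`. [folklore] -/
theorem integrable_inner_fderiv_realTrigPoly_coe (S : Finset (d → ℤ))
    (c : (d → ℤ) → EuclideanSpace ℂ d)
    (a b : Lp (EuclideanSpace ℝ d) 2 (volume : Measure (UnitAddTorus d))) :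
    Integrable (fun x => ⟪Torus.fderiv (Torus.realTrigPoly S c) x (a x), b x⟫) volume ∧
      |∫ x, ⟪Torus.fderiv (Torus.realTrigPoly S c) x (a x), b x⟫| ≤
        (∑ i, ∑ k ∈ S, 2 * Real.pi * |(k i : ℝ)| * ‖c k‖) * (‖a‖ * ‖b‖) :=
  Torus.integrable_inner_fderiv_apply_coe (Torus.isSmooth_realTrigPoly S c)
    (fun x => Finset.sum_le_sum fun i _ => Torus.norm_partialDeriv_realTrigPoly_le S c i x) a b

/-- **Joint continuity estimate for the convective form with a moving trigonometric test field**: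
for coefficients `c, c′` on `S` and `a, b ∈ L²`,
`|B_c(a,a) − B_{c′}(b,b)| ≤ K(c) (‖a − b‖ ‖a‖ + ‖b‖ ‖a − b‖) + K(c − c′) ‖b‖²`, where
`B_c(a,b) = ∫ ⟪D(realTrigPoly S c) a, b⟫` and `K(c) = Σᵢ Σ_{k ∈ S} 2π |kᵢ| ‖c k‖`
(bilinearity in `(a, b)`, additivity in `c`, and the bound of
`integrable_inner_fderiv_realTrigPoly_coe`). [folklore] -/
theorem abs_integral_inner_fderiv_realTrigPoly_sub_le (S : Finset (d → ℤ))
    (c c' : (d → ℤ) → EuclideanSpace ℂ d)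
    (a b : Lp (EuclideanSpace ℝ d) 2 (volume : Measure (UnitAddTorus d))) :
    |(∫ x, ⟪Torus.fderiv (Torus.realTrigPoly S c) x (a x), a x⟫) -
        ∫ x, ⟪Torus.fderiv (Torus.realTrigPoly S c') x (b x), b x⟫| ≤
      (∑ i, ∑ k ∈ S, 2 * Real.pi * |(k i : ℝ)| * ‖c k‖) * (‖a - b‖ * ‖a‖) +
        (∑ i, ∑ k ∈ S, 2 * Real.pi * |(k i : ℝ)| * ‖c k‖) * (‖b‖ * ‖a - b‖) +
          (∑ i, ∑ k ∈ S, 2 * Real.pi * |(k i : ℝ)| * ‖c k - c' k‖) * (‖b‖ * ‖b‖) := by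
  -- the family of bilinear forms and its bounds
  set B : ((d → ℤ) → EuclideanSpace ℂ d) →
      Lp (EuclideanSpace ℝ d) 2 (volume : Measure (UnitAddTorus d)) →
        Lp (EuclideanSpace ℝ d) 2 (volume : Measure (UnitAddTorus d)) → ℝ :=
    fun e a b => ∫ x, ⟪Torus.fderiv (Torus.realTrigPoly S e) x (a x), b x⟫ with hB
  have hBi := fun e a b => (integrable_inner_fderiv_realTrigPoly_coe S e a b).1
  have hBb : ∀ e a b,
      |B e a b| ≤ (∑ i, ∑ k ∈ S, 2 * Real.pi * |(k i : ℝ)| * ‖e k‖) * (‖a‖ * ‖b‖) :=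
    fun e a b => (integrable_inner_fderiv_realTrigPoly_coe S e a b).2
  have h1 : ∀ e, Torus.IsContDiff 1 (Torus.realTrigPoly S e) := fun e =>
    (Torus.isSmooth_realTrigPoly S e).isContDiff (by simp)
  -- linearity in the first slot
  have hsub₁ : ∀ e a₁ a₂ b, B e (a₁ - a₂) b = B e a₁ b - B e a₂ b := by
    intro e a₁ a₂ b
    simp only [hB]
    rw [← integral_sub (hBi e a₁ b) (hBi e a₂ b)]
    refine integral_congr_ae ?_
    filter_upwards [Lp.coeFn_sub a₁ a₂] with x hx
    rw [hx, Pi.sub_apply, map_sub, inner_sub_left]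
  -- linearity in the second slot
  have hsub₂ : ∀ e a b₁ b₂, B e a (b₁ - b₂) = B e a b₁ - B e a b₂ := by
    intro e a b₁ b₂
    simp only [hB]
    rw [← integral_sub (hBi e a b₁) (hBi e a b₂)]
    refine integral_congr_ae ?_
    filter_upwards [Lp.coeFn_sub b₁ b₂] with x hx
    rw [hx, Pi.sub_apply, inner_sub_right]
  -- additivity in the coefficients
  have hsub₃ : ∀ e e' a b, B e a b = B e' a b + B (e - e') a b := by
    intro e e' a b
    simp only [hB]
    rw [← integral_add (hBi e' a b) (hBi (e - e') a b)]
    refine integral_congr_ae (ae_of_all _ fun x => ?_)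
    dsimp only
    have he : Torus.realTrigPoly S e =
        Torus.realTrigPoly S e' + Torus.realTrigPoly S (e - e') := by
      rw [← Torus.realTrigPoly_add, add_sub_cancel]
    rw [he, Torus.fderiv_add (h1 e') (h1 (e - e')), _root_.add_apply, inner_add_left]
  have hdiff : B c a a - B c' b b = B c (a - b) a + B c b (a - b) + B (c - c') b b := by
    rw [hsub₁, hsub₂, hsub₃ c c' b b]
    ring
  have hcc : (∑ i, ∑ k ∈ S, 2 * Real.pi * |(k i : ℝ)| * ‖c k - c' k‖) =
      ∑ i, ∑ k ∈ S, 2 * Real.pi * |(k i : ℝ)| * ‖(c - c') k‖ := by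
    simp only [Pi.sub_apply]
  change |B c a a - B c' b b| ≤ _
  rw [hdiff, hcc]
  exact (abs_add_le _ _).trans (add_le_add ((abs_add_le _ _).trans
    (add_le_add (hBb _ _ _) (hBb _ _ _))) (hBb _ _ _))

/-! ### The stub -/

/-- **L′ `stub_continuous_flux`.** For every cutoff `m`, the energy flux
`u ↦ Π_m(u) = ∫ ⟪∇(P_m u)(x) u(x), u(x)⟫ dx` is continuous on `H = L²_σ(T³)` (norm
topology): `P_m u` is a real trigonometric polynomial whose finitely many coefficients are
continuous functionals of `u`, and the joint estimate
`abs_integral_inner_fderiv_realTrigPoly_sub_le` bounds `|Π_m(u) − Π_m(v₀)|` by a continuous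
function of `u` vanishing at `v₀`. [folklore] -/
theorem stub_continuous_flux :
    ∀ m : ℕ, Continuous fun u : Torus.energySpace (Fin 3) =>
      Torus.inertialPairing u.1 (Torus.fourierTruncate m
        (u.1 : UnitAddTorus (Fin 3) → EuclideanSpace ℝ (Fin 3))) := by
  intro m
  -- the Fourier coefficients of `u ∈ H` are continuous functionals of `u`
  have hc : ∀ k : Fin 3 → ℤ, Continuous fun u : Torus.energySpace (Fin 3) =>
      UnitAddTorus.mFourierCoeff (EuclideanSpace.complexify ∘
        (u.1 : UnitAddTorus (Fin 3) → EuclideanSpace ℝ (Fin 3))) k :=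
    fun k => MomentParityMomentClosure.continuous_mFourierCoeff_coe k
  -- the derivative constants `K(û)` and `K(û − v̂₀)` as continuous functions of `u`
  obtain ⟨K, hKc, hK⟩ : ∃ K : Torus.energySpace (Fin 3) → ℝ, Continuous K ∧ ∀ u,
      K u = ∑ i, ∑ k ∈ Torus.freqBall m, 2 * Real.pi * |(k i : ℝ)| *
        ‖UnitAddTorus.mFourierCoeff (EuclideanSpace.complexify ∘
          (u.1 : UnitAddTorus (Fin 3) → EuclideanSpace ℝ (Fin 3))) k‖ :=
    ⟨_, continuous_finsetSum _ fun i _ => continuous_finsetSum _ fun k _ =>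
      continuous_const.mul (hc k).norm, fun u => rfl⟩
  refine continuous_iff_continuousAt.2 fun v₀ => ?_
  obtain ⟨K', hK'c, hK'⟩ : ∃ K' : Torus.energySpace (Fin 3) → ℝ, Continuous K' ∧ ∀ u,
      K' u = ∑ i, ∑ k ∈ Torus.freqBall m, 2 * Real.pi * |(k i : ℝ)| *
        ‖UnitAddTorus.mFourierCoeff (EuclideanSpace.complexify ∘
            (u.1 : UnitAddTorus (Fin 3) → EuclideanSpace ℝ (Fin 3))) k -
          UnitAddTorus.mFourierCoeff (EuclideanSpace.complexify ∘
            (v₀.1 : UnitAddTorus (Fin 3) → EuclideanSpace ℝ (Fin 3))) k‖ :=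
    ⟨_, continuous_finsetSum _ fun i _ => continuous_finsetSum _ fun k _ =>
      continuous_const.mul ((hc k).sub continuous_const).norm, fun u => rfl⟩
  have hK'0 : K' v₀ = 0 := by
    rw [hK']
    simp
  rw [ContinuousAt, tendsto_iff_norm_sub_tendsto_zero]
  -- the dominating continuous function
  have hgc : Continuous fun u : Torus.energySpace (Fin 3) =>
      K u * (‖u.1 - v₀.1‖ * ‖u.1‖) + K u * (‖v₀.1‖ * ‖u.1 - v₀.1‖) +
        K' u * (‖v₀.1‖ * ‖v₀.1‖) := by
    have hn : Continuous fun u : Torus.energySpace (Fin 3) => ‖u.1 - v₀.1‖ :=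
      (continuous_subtype_val.sub continuous_const).norm
    have hn' : Continuous fun u : Torus.energySpace (Fin 3) => ‖u.1‖ :=
      continuous_subtype_val.norm
    exact ((hKc.mul (hn.mul hn')).add (hKc.mul (continuous_const.mul hn))).add
      (hK'c.mul continuous_const)
  have hlim : Tendsto (fun u : Torus.energySpace (Fin 3) =>
      K u * (‖u.1 - v₀.1‖ * ‖u.1‖) + K u * (‖v₀.1‖ * ‖u.1 - v₀.1‖) +
        K' u * (‖v₀.1‖ * ‖v₀.1‖)) (𝓝 v₀) (𝓝 0) := by
    simpa [hK'0] using hgc.tendsto v₀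
  refine squeeze_zero_norm' (Eventually.of_forall fun u => ?_) hlim
  rw [norm_norm, Real.norm_eq_abs, hK u, hK' u]
  exact abs_integral_inner_fderiv_realTrigPoly_sub_le (Torus.freqBall m) _ _ u.1 v₀.1

end Summit.AnomalousDissipation.AnomalousDissipation.Theorems.MomentParityResolvedDissipation.ContinuousFlux
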